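import Summits.HubbardSuperconductivity.HubbardSuperconductivity.Theorems.BalabanIRBirComplexStableXYEvenPositivity
import Summits.HubbardSuperconductivity.HubbardSuperconductivity.Theorems.BalabanIRBirComplexStableXYReality
import Summits.HubbardSuperconductivity.HubbardSuperconductivity.Theorems.BirComplexStableXY.Negative.WitnessTable
import HarnessLib

/-!
# Crux `BirComplexStableXYR` (stmt-HubbardSuperconductivity-14845): the multi-slice (`r ≥ 3`)
transfer structure of the complex window action — factorisation, reversal-Hermiticity of the
`r`-slice kernel, `S`-pseudo-Hermiticity of the `(r-1)`-block kernel

Support file (`--supports stmt-HubbardSuperconductivity-14845`) for the registered stub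
`stub_complexPositivity` of line `log-concave-core-bounded-phase` (skeleton S3,
`Cruxes/BirComplexStableXYR/Lines/log_concave_core_bounded_phase.lean`):
`0 < Re Z ∧ Im Z = 0` for every admissible (U1)(N)(A)(C)(R)(P) table, `K ≥ K₀(r,B,c₀)`, even
`L₀ ≤ L ≤ M`.  Written over the named pieces `genF`, `sh`, `action`, `cube`, `partZ`, `Table`, `Freq`
of `Theorems.BirComplexStableXY.Negative.WitnessTable` (the stub's binder shape).

* §0 `birMulti_complexPositivity_reduction` — what is LEFT of the stub after the landed facts: the
  `r = 2` instance is the landed `birEven_partitionFunction_pos` (every `K`, `L`, even `M`) and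
  `Im Z = 0` is the landed (R)-reality `partitionFunction_conj_eq_self` (every `r`); so the stub is
  implied by (indeed equivalent to) the bare real-part positivity `0 < Re Z` for `r ≥ 3`.
* §1 `birMulti_action_factorises` — for EVERY `r`, reading a space-time configuration slice by slice
  (`θ (x, τ) = σ τ x`) the weight factorises over time, `exp(-A θ) = ∏_τ k_r(σ_τ, σ_{τ+1}, …, σ_{τ+r-1})`,
  with the `r`-slice kernel `k_r(η) = exp(-K Σ_x F(w ↦ η_{w₃}(x + (w₁,w₂))))`.
* §2 `birMulti_kernel_rev` — under the TABLE form of (R) (`c_{n∘R} = conj c_{-n}`) the `r`-slice kernel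
  is reversal-Hermitian: `k_r(η ∘ rev) = conj (k_r η)`.
* §3 `birMulti_kernel_continuous`, `…_norm_le`, `…_ne_zero`, `…_norm_le_one` — `k_r` is continuous,
  bounded, nowhere zero, and of modulus `≤ 1` under (C) for `K, c₀ ≥ 0`.
* §4 `birMulti_block_pseudoHerm` (abstract form `…_of`) — for `r = q + 1` the `(r-1)`-block transfer
  kernel `T(Σ, Σ') = ∏_{i<q} k_r((Σ ++ Σ') ∘ (l ↦ i + l))` (all windows starting inside the block `Σ`)
  satisfies `T(Σ' ∘ rev, Σ ∘ rev) = conj T(Σ, Σ')`, i.e. `T* = S T S` for the unitary involution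
  `S` = reversal of the internal slice order: the multi-slice transfer operator is only
  `S`-PSEUDO-Hermitian (for `r = 2`, `q = 1`, `S = id` and this is the Hermiticity `birKernel_herm`
  behind `birEven_partitionFunction_pos`; for `r ≥ 3` no positivity follows — the open content of
  the stub, cf. the crux's `Disproof.lean` §4b(3)).
* §5 `birMulti_action_factorises_blocks` (abstract form `birMulti_prod_blocks_kernel`, with the
  circle-splitting `birMulti_prod_blocks` and the wrap-around bookkeeping `birMulti_blockIndex_*`) —
  when `q = r - 1` divides `M = q·m`, `exp(-A θ) = ∏_{j : ZMod m} T(Σ_j, Σ_{j+1})` with the blocks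
  `Σ_j = (σ_{qj+i'})_{i'<q}`: the path-integral form of `Z = Tr T^m` (for `q = 1`: `birAction_factorises`).

What is NOT here (the missing theorem behind the stub, no Literature def exists for it): a
volume-uniform low-temperature (multiscale cluster) expansion of `log Z` for admissible tables at
`r ≥ 3`, giving `log Z = (real local terms) + (convergent remainder)` uniformly in even `L₀ ≤ L ≤ M`.
-/

noncomputable section

namespace Summit.HubbardSuperconductivity.HubbardSuperconductivity.Theorems

open scoped BigOperators ComplexConjugate
open MeasureTheory Literature.Probability.LatticeModels
open Summit.HubbardSuperconductivity.BirComplexStableXYNegative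

/-! ## §0 Reduction of the stub to real-part positivity for `r ≥ 3` -/

/-- **What remains of `stub_complexPositivity`.**  If `0 < Re Z` holds for every `r ≥ 3` (same
quantifiers and hypotheses as the stub), then the full stub `0 < Re Z ∧ Im Z = 0` holds for every
`r ≥ 2`: the case `r = 2` is `birEven_partitionFunction_pos` (with `K₀ = 0`, `L₀ = 0`, via the
table ⇒ functional bridge `timeReflection_functional_of_table`), and `Im Z = 0` is the (R)-reality
`partitionFunction_conj_eq_self`. [folklore] -/
theorem birMulti_complexPositivity_reduction :
    (∀ (r : ℕ) (B c₀ : ℝ), 3 ≤ r → 0 < c₀ → ∃ K₀ : ℝ, ∃ L₀ : ℕ, ∀ K : ℝ, K₀ ≤ K → ∀ c : Table r, (∀ n ∈ c.support, ∑ w, n w = 0) → c.sum (fun _ a => a) = 0 → normA c ≤ B → (∀ φ : W r → ℝ, c₀ * ∑ w, ∑ w', (1 - Real.cos (φ w - φ w')) ≤ (genF c φ).re) → (∀ n : Freq r, c (fun w => n (w.1, w.2.1, Fin.rev w.2.2)) = (starRingEnd ℂ) (c (-n))) → (∀ n : Freq r, c (fun w => n (Fin.rev w.1, Fin.rev w.2.1,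 w.2.2)) = c n) → ∀ (L M : ℕ) [NeZero L] [NeZero M], L₀ ≤ L → L ≤ M → Even L → Even M → 0 < (partZ K c L M).re) → ∀ (r : ℕ) (B c₀ : ℝ), 2 ≤ r → 0 < c₀ → ∃ K₀ : ℝ, ∃ L₀ : ℕ, ∀ K : ℝ, K₀ ≤ K → ∀ c : Table r, (∀ n ∈ c.support, ∑ w, n w = 0) → c.sum (fun _ a => a) = 0 → normA c ≤ B → (∀ φ : W r → ℝ, c₀ * ∑ w, ∑ w', (1 - Real.cos (φ w - φ w')) ≤ (genF c φ).re) → (∀ n : Freq r, c (fun w => n (w.1, w.2.1, Fin.rev w.2.2)) = (starRingEnd ℂ) (c (-n))) → (∀ n : Freq r, c (fun w => n (Fin.rev w.1, Fin.rev w.2.1, w.2.2)) = c n) → ∀ (L M : ℕ) [NeZero L] [NeZero M], L₀ ≤ L → L ≤ M → Even L → Even M → 0 < (partZ K c L M).re ∧ (partZ K c L M).im = 0 := by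
  intro h3 r B c₀ hr hc₀
  -- `Im Z = 0` for every `r`, from (R)
  have him : ∀ (r : ℕ) (K : ℝ) (c : Table r),
      (∀ n : Freq r, c (fun w => n (w.1, w.2.1, Fin.rev w.2.2)) = (starRingEnd ℂ) (c (-n))) →
      ∀ (L M : ℕ) [NeZero L] [NeZero M], (partZ K c L M).im = 0 := by
    intro r K c hR L M _ _
    have hz := partitionFunction_conj_eq_self r c K L M (timeReflection_functional_of_table r c hR)
    dsimp only at hz
    have hz' := Complex.conj_eq_iff_im.mp hz
    dsimp only [partZ, action, genF, sh, cube]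
    exact hz'
  rcases (show r = 2 ∨ 3 ≤ r by omega) with rfl | h3r
  · refine ⟨0, 0, ?_⟩
    intro K _ c _ _ _ _ hR _ L M _ _ _ _ _ hM
    have h := birEven_partitionFunction_pos c K L M (timeReflection_functional_of_table 2 c hR) hM
    dsimp only at h
    refine ⟨?_, him 2 K c hR L M⟩
    dsimp only [partZ, action, genF, sh, cube]
    exact h.1
  · obtain ⟨K₀, L₀, H⟩ := h3 r B c₀ h3r hc₀
    refine ⟨K₀, L₀, ?_⟩
    intro K hK c hU1 hN hA hC hR hP L M _ _ hL0 hLM hLe hMe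
    exact ⟨H K hK c hU1 hN hA hC hR hP L M hL0 hLM hLe hMe, him r K c hR L M⟩

/-! ## §1 Factorisation over time slices for every window range `r` -/

variable {r : ℕ}

/-- **Factorisation over time slices (every `r`).**  Reading a space-time configuration slice by
slice, `θ (x, τ) = σ τ x`, the weight of the window action is the cyclic product over `τ : ZMod M`
of the `r`-slice kernels `k_r(σ_τ, …, σ_{τ+r-1}) = exp(-K Σ_x F(w ↦ σ_{τ+w₃}(x + (w₁,w₂))))`.
(For `r = 2` this is `birAction_factorises`.) [folklore] -/
theorem birMulti_action_factorises (K : ℝ) (c : Table r) (L M : ℕ) [NeZero L] [NeZero M]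
    (σ : ZMod M → TorusSite 2 L → ℝ) :
    Complex.exp (-(action K c L M (fun s => σ s.2 s.1))) =
      ∏ τ : ZMod M, Complex.exp (-((K : ℂ) * ∑ x : TorusSite 2 L, genF c (fun w =>
        (fun i : Fin r => σ (τ + ((i : ℕ) : ZMod M))) w.2.2
          (x + ![((w.1 : ℕ) : ZMod L), ((w.2.1 : ℕ) : ZMod L)])))) := by
  unfold action
  rw [Fintype.sum_prod_type_right, Finset.mul_sum, ← Finset.sum_neg_distrib, Complex.exp_sum]
  rfl

/-! ## §2 (R) ⇒ reversal-Hermiticity of the `r`-slice kernel -/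

/-- **Time-reflection reality makes the `r`-slice kernel reversal-Hermitian.**  Under the table
form of (R), `c_{n∘R} = conj c_{-n}` (`R (w₁,w₂,w₃) = (w₁,w₂,rev w₃)`), reversing the order of the
`r` slices conjugates the kernel: `k_r(η ∘ rev) = conj (k_r η)` for every real `K`.
(For `r = 2` this is `birKernel_herm`.) [folklore] -/
theorem birMulti_kernel_rev (c : Table r)
    (hR : ∀ n : Freq r, c (fun w => n (w.1, w.2.1, Fin.rev w.2.2)) = (starRingEnd ℂ) (c (-n)))
    (K : ℝ) (L : ℕ) [NeZero L] (η : Fin r → TorusSite 2 L → ℝ) :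
    Complex.exp (-((K : ℂ) * ∑ x : TorusSite 2 L, genF c (fun w =>
        (fun i : Fin r => η (Fin.rev i)) w.2.2 (x + ![((w.1 : ℕ) : ZMod L), ((w.2.1 : ℕ) : ZMod L)])))) =
      conj (Complex.exp (-((K : ℂ) * ∑ x : TorusSite 2 L, genF c (fun w =>
        η w.2.2 (x + ![((w.1 : ℕ) : ZMod L), ((w.2.1 : ℕ) : ZMod L)]))))) := by
  have hRF := timeReflection_functional_of_table r c hR
  rw [← Complex.exp_conj, map_neg, map_mul, Complex.conj_ofReal, map_sum]
  congr 3
  refine Finset.sum_congr rfl fun x _ => ?_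
  exact hRF (fun w => η w.2.2 (x + ![((w.1 : ℕ) : ZMod L), ((w.2.1 : ℕ) : ZMod L)]))

/-! ## §3 Continuity and bounds of the `r`-slice kernel -/

/-- The `r`-slice window configuration `w ↦ η_{w₃}(x + (w₁,w₂))` depends continuously on `η`. -/
theorem birMulti_window_continuous (L : ℕ) (x : TorusSite 2 L) :
    Continuous (fun η : Fin r → TorusSite 2 L → ℝ => fun w : W r =>
      η w.2.2 (x + ![((w.1 : ℕ) : ZMod L), ((w.2.1 : ℕ) : ZMod L)])) :=
  continuous_pi fun w => (continuous_apply _).comp (continuous_apply w.2.2)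

/-- The `r`-slice kernel is continuous in the `r` slices. [folklore] -/
theorem birMulti_kernel_continuous (K : ℝ) (c : Table r) (L : ℕ) [NeZero L] :
    Continuous (fun η : Fin r → TorusSite 2 L → ℝ =>
      Complex.exp (-((K : ℂ) * ∑ x : TorusSite 2 L, genF c (fun w =>
        η w.2.2 (x + ![((w.1 : ℕ) : ZMod L), ((w.2.1 : ℕ) : ZMod L)]))))) := by
  have hFc : Continuous (genF (r := r) c) := (birLocalF_continuous_bound c).1
  refine Complex.continuous_exp.comp (Continuous.neg (continuous_const.mul ?_))
  exact continuous_finsetSum _ fun x _ => hFc.comp (birMulti_window_continuous L x)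

/-- The `r`-slice kernel is bounded by `exp(|K| · L² · Σ_n ‖c_n‖)`. [folklore] -/
theorem birMulti_kernel_norm_le (K : ℝ) (c : Table r) (L : ℕ) [NeZero L] (η : Fin r → TorusSite 2 L → ℝ) :
    ‖Complex.exp (-((K : ℂ) * ∑ x : TorusSite 2 L, genF c (fun w =>
        η w.2.2 (x + ![((w.1 : ℕ) : ZMod L), ((w.2.1 : ℕ) : ZMod L)]))))‖ ≤
      Real.exp (|K| * (Fintype.card (TorusSite 2 L) * ∑ n ∈ c.support, ‖c n‖)) := by
  have hFb : ∀ φ, ‖genF c φ‖ ≤ ∑ n ∈ c.support, ‖c n‖ := (birLocalF_continuous_bound c).2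
  rw [Complex.norm_exp]
  refine Real.exp_le_exp.mpr ?_
  have hS : ‖∑ x : TorusSite 2 L, genF c (fun w =>
      η w.2.2 (x + ![((w.1 : ℕ) : ZMod L), ((w.2.1 : ℕ) : ZMod L)]))‖
        ≤ Fintype.card (TorusSite 2 L) * ∑ n ∈ c.support, ‖c n‖ := by
    refine (norm_sum_le _ _).trans ?_
    calc ∑ x : TorusSite 2 L, ‖genF c (fun w =>
            η w.2.2 (x + ![((w.1 : ℕ) : ZMod L), ((w.2.1 : ℕ) : ZMod L)]))‖
        ≤ ∑ _x : TorusSite 2 L, ∑ n ∈ c.support, ‖c n‖ := Finset.sum_le_sum fun x _ => hFb _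
      _ = Fintype.card (TorusSite 2 L) * ∑ n ∈ c.support, ‖c n‖ := by simp
  calc (-((K : ℂ) * ∑ x : TorusSite 2 L, genF c (fun w =>
          η w.2.2 (x + ![((w.1 : ℕ) : ZMod L), ((w.2.1 : ℕ) : ZMod L)])))).re
      ≤ ‖-((K : ℂ) * ∑ x : TorusSite 2 L, genF c (fun w =>
          η w.2.2 (x + ![((w.1 : ℕ) : ZMod L), ((w.2.1 : ℕ) : ZMod L)])))‖ := Complex.re_le_norm _
    _ ≤ |K| * (Fintype.card (TorusSite 2 L) * ∑ n ∈ c.support, ‖c n‖) := by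
        rw [norm_neg, norm_mul, Complex.norm_real, Real.norm_eq_abs]
        exact mul_le_mul_of_nonneg_left hS (abs_nonneg K)

/-- The `r`-slice kernel never vanishes. [folklore] -/
theorem birMulti_kernel_ne_zero (K : ℝ) (c : Table r) (L : ℕ) [NeZero L] (η : Fin r → TorusSite 2 L → ℝ) :
    Complex.exp (-((K : ℂ) * ∑ x : TorusSite 2 L, genF c (fun w =>
        η w.2.2 (x + ![((w.1 : ℕ) : ZMod L), ((w.2.1 : ℕ) : ZMod L)])))) ≠ 0 :=
  Complex.exp_ne_zero _

/-- Under the coercivity hypothesis (C) (with `c₀ ≥ 0`) and `K ≥ 0` the `r`-slice kernel has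
modulus `≤ 1` (so the multi-slice transfer operator is a contraction in sup norm up to the volume
of the slice cube). [folklore] -/
theorem birMulti_kernel_norm_le_one {K c₀ : ℝ} (hK : 0 ≤ K) (hc₀ : 0 ≤ c₀) (c : Table r)
    (hC : ∀ φ : W r → ℝ, c₀ * ∑ w, ∑ w', (1 - Real.cos (φ w - φ w')) ≤ (genF c φ).re)
    (L : ℕ) [NeZero L] (η : Fin r → TorusSite 2 L → ℝ) :
    ‖Complex.exp (-((K : ℂ) * ∑ x : TorusSite 2 L, genF c (fun w =>
        η w.2.2 (x + ![((w.1 : ℕ) : ZMod L), ((w.2.1 : ℕ) : ZMod L)]))))‖ ≤ 1 := by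
  rw [Complex.norm_exp]
  apply Real.exp_le_one_iff.mpr
  have hre : ∀ φ : W r → ℝ, 0 ≤ (genF c φ).re := fun φ =>
    le_trans (mul_nonneg hc₀ (Finset.sum_nonneg fun _ _ => Finset.sum_nonneg fun _ _ =>
      sub_nonneg.2 (Real.cos_le_one _))) (hC φ)
  have : 0 ≤ ((K : ℂ) * ∑ x : TorusSite 2 L, genF c (fun w =>
      η w.2.2 (x + ![((w.1 : ℕ) : ZMod L), ((w.2.1 : ℕ) : ZMod L)]))).re := by
    simp only [Complex.mul_re, Complex.ofReal_re, Complex.ofReal_im, zero_mul, sub_zero,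
      Complex.re_sum]
    exact mul_nonneg hK (Finset.sum_nonneg fun x _ => hre _)
  simpa using this

/-! ## §4 The `(r-1)`-block transfer kernel is `S`-pseudo-Hermitian (`r = q + 1`) -/

/-- Index bookkeeping: a window of `q + 1` consecutive slices starting in the first of two
consecutive `q`-blocks stays inside the pair of blocks. -/
theorem birMulti_window_lt {q : ℕ} (i : Fin q) (l : Fin (q + 1)) : (i : ℕ) + l < q + q := by
  have := i.isLt
  have := l.isLt
  omega

/-- Reversal bookkeeping: reversing the starting position inside the block and the position
inside the window reverses the position inside the pair of blocks. -/
theorem birMulti_window_rev {q : ℕ} (i : Fin q) (l : Fin (q + 1)) :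
    (⟨((Fin.rev i : Fin q) : ℕ) + ((Fin.rev l : Fin (q + 1)) : ℕ),
        birMulti_window_lt (Fin.rev i) (Fin.rev l)⟩ : Fin (q + q)) =
      Fin.rev ⟨(i : ℕ) + l, birMulti_window_lt i l⟩ := by
  ext
  have := i.isLt
  have := l.isLt
  simp only [Fin.val_rev]
  omega

/-- **Abstract `S`-pseudo-Hermiticity of a block kernel.**  For ANY slice space `X` and any
`(q+1)`-slice kernel `k` that is reversal-Hermitian (`k(η ∘ rev) = conj (k η)`), the block kernel
`T(ξ, ζ) = ∏_{i<q} k((ξ ++ ζ) ∘ (l ↦ i + l))` on pairs of `q`-blocks satisfies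
`T(ζ ∘ rev, ξ ∘ rev) = conj T(ξ, ζ)` (`T* = S T S`, `S` = reversal of the internal slice order).
Pure `Fin.append`/`Fin.rev` bookkeeping. [folklore] -/
theorem birMulti_block_pseudoHerm_of {X : Type*} {q : ℕ} (k : (Fin (q + 1) → X) → ℂ)
    (hrev : ∀ η : Fin (q + 1) → X, k (fun i => η (Fin.rev i)) = conj (k η)) (ξ ζ : Fin q → X) :
    (∏ i : Fin q, k (fun l : Fin (q + 1) => Fin.append (fun j => ζ (Fin.rev j)) (fun j => ξ (Fin.rev j))
        ⟨(i : ℕ) + l, birMulti_window_lt i l⟩)) =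
      conj (∏ i : Fin q, k (fun l : Fin (q + 1) => Fin.append ξ ζ ⟨(i : ℕ) + l, birMulti_window_lt i l⟩)) := by
  -- the windows of the reversed pair of blocks are the reversed windows, read from the other end
  have hwin : ∀ (i : Fin q) (l : Fin (q + 1)),
      Fin.append (fun j => ζ (Fin.rev j)) (fun j => ξ (Fin.rev j)) ⟨(i : ℕ) + l, birMulti_window_lt i l⟩ =
        Fin.append ξ ζ ⟨((Fin.rev i : Fin q) : ℕ) + ((Fin.rev l : Fin (q + 1)) : ℕ),
          birMulti_window_lt (Fin.rev i) (Fin.rev l)⟩ := by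
    intro i l
    rw [birMulti_window_rev i l, Fin.append_rev]
    rfl
  rw [map_prod]
  refine Fintype.prod_equiv Fin.revPerm _ _ fun i => ?_
  rw [Fin.revPerm_apply]
  refine Eq.trans ?_ (hrev (fun l => Fin.append ξ ζ
    ⟨((Fin.rev i : Fin q) : ℕ) + l, birMulti_window_lt (Fin.rev i) l⟩))
  congr 1
  funext l
  exact hwin i l

/-- **`S`-pseudo-Hermiticity of the block transfer kernel (`r = q + 1`, every `q ≥ 1`).**  Group the
time slices into blocks of `q = r - 1` consecutive slices, `Σ = (σ_{qj}, …, σ_{qj+q-1})`.  Every window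
of temporal range `r` starting in block `j` lies in the pair of blocks `(j, j+1)`, so (when `q ∣ M`)
`exp(-A) = ∏_j T(Σ_j, Σ_{j+1})` with the block kernel
`T(Σ, Σ') = ∏_{i<q} k_r((Σ ++ Σ') ∘ (l ↦ i + l))` built from the `r`-slice kernel `k_r` of
`birMulti_action_factorises`.  Under the table form of (R) this kernel satisfies
`T(Σ' ∘ rev, Σ ∘ rev) = conj T(Σ, Σ')`, i.e. `T* = S T S` for the unitary involution `S` reversing the
internal slice order of a block: the multi-slice transfer operator is `S`-pseudo-Hermitian (for `q = 1`
this is the Hermiticity `birKernel_herm`; for `q ≥ 2`, `S ≠ id` and no positivity of `Tr T^m` follows).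
[folklore] -/
theorem birMulti_block_pseudoHerm {q : ℕ} (c : Table (q + 1))
    (hR : ∀ n : Freq (q + 1), c (fun w => n (w.1, w.2.1, Fin.rev w.2.2)) = (starRingEnd ℂ) (c (-n)))
    (K : ℝ) (L : ℕ) [NeZero L] (ξ ζ : Fin q → TorusSite 2 L → ℝ) :
    (∏ i : Fin q, Complex.exp (-((K : ℂ) * ∑ x : TorusSite 2 L, genF c (fun w =>
        (fun l : Fin (q + 1) => Fin.append (fun j => ζ (Fin.rev j)) (fun j => ξ (Fin.rev j))
          ⟨(i : ℕ) + l, birMulti_window_lt i l⟩) w.2.2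
          (x + ![((w.1 : ℕ) : ZMod L), ((w.2.1 : ℕ) : ZMod L)]))))) =
      conj (∏ i : Fin q, Complex.exp (-((K : ℂ) * ∑ x : TorusSite 2 L, genF c (fun w =>
        (fun l : Fin (q + 1) => Fin.append ξ ζ ⟨(i : ℕ) + l, birMulti_window_lt i l⟩) w.2.2
          (x + ![((w.1 : ℕ) : ZMod L), ((w.2.1 : ℕ) : ZMod L)]))))) :=
  birMulti_block_pseudoHerm_of (fun η : Fin (q + 1) → TorusSite 2 L → ℝ =>
    Complex.exp (-((K : ℂ) * ∑ x : TorusSite 2 L, genF c (fun w =>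
      η w.2.2 (x + ![((w.1 : ℕ) : ZMod L), ((w.2.1 : ℕ) : ZMod L)])))))
    (birMulti_kernel_rev c hR K L) ξ ζ

/-! ## §5 Block factorisation of the weight when `q = r - 1` divides `M` -/

/-- Slice `i` of block `j` sits at time `τ = q·j + i` on the temporal circle `ZMod M`, `M = q·m`;
distinct (block, position) pairs give distinct times. -/
theorem birMulti_blockIndex_injective {M q m : ℕ} [NeZero m] (hM : M = q * m) :
    Function.Injective (fun p : ZMod m × Fin q => (((q * ZMod.val p.1 + p.2 : ℕ)) : ZMod M)) := by
  rintro ⟨j, i⟩ ⟨j', i'⟩ h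
  have hlt : ∀ (j : ZMod m) (i : Fin q), q * ZMod.val j + i < M := fun j i => by
    have hj := ZMod.val_lt j
    have hi := i.isLt
    calc q * j.val + i < q * j.val + q := by omega
      _ = q * (j.val + 1) := by ring
      _ ≤ q * m := Nat.mul_le_mul_left q hj
      _ = M := hM.symm
  have h' : q * ZMod.val j + i = q * ZMod.val j' + i' := by
    have := (ZMod.natCast_eq_natCast_iff' (q * ZMod.val j + i) (q * ZMod.val j' + i') M).mp h
    rwa [Nat.mod_eq_of_lt (hlt j i), Nat.mod_eq_of_lt (hlt j' i')] at this
  have hq : 0 < q := lt_of_le_of_lt (Nat.zero_le _) i.isLt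
  have hi : (i : ℕ) = i' := by
    have h1 := congrArg (· % q) h'
    simpa only [Nat.mul_add_mod, Nat.mod_eq_of_lt i.isLt, Nat.mod_eq_of_lt i'.isLt] using h1
  have hj : ZMod.val j = ZMod.val j' := by
    have h1 := congrArg (· / q) h'
    simpa only [Nat.mul_add_div hq, Nat.div_eq_of_lt i.isLt, Nat.div_eq_of_lt i'.isLt,
      Nat.add_zero] using h1
  exact Prod.ext (ZMod.val_injective m hj) (Fin.ext hi)

/-- **Splitting a product over the temporal circle into blocks.**  For `M = q·m`,
`∏_{τ : ZMod M} g τ = ∏_{j : ZMod m} ∏_{i < q} g (q·j + i)`. -/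
theorem birMulti_prod_blocks {M q m : ℕ} [NeZero M] [NeZero m] (hM : M = q * m) (g : ZMod M → ℂ) :
    ∏ τ : ZMod M, g τ = ∏ j : ZMod m, ∏ i : Fin q, g (((q * ZMod.val j + i : ℕ)) : ZMod M) := by
  have hbij : Function.Bijective
      (fun p : ZMod m × Fin q => (((q * ZMod.val p.1 + p.2 : ℕ)) : ZMod M)) := by
    refine (Fintype.bijective_iff_injective_and_card _).mpr ⟨birMulti_blockIndex_injective hM, ?_⟩
    simp [ZMod.card, hM, mul_comm]
  rw [← Fintype.prod_prod_type' (f := fun (j : ZMod m) (i : Fin q) =>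
    g (((q * ZMod.val j + i : ℕ)) : ZMod M))]
  exact (Equiv.prod_comp (Equiv.ofBijective _ hbij) g).symm

/-- Consecutive blocks start `q` slices apart: `q·(j+1) = q·j + q` on `ZMod M`, `M = q·m` (this is
where the wrap-around of the last block onto the first is handled). -/
theorem birMulti_blockIndex_succ {M q m : ℕ} [NeZero m] (hM : M = q * m) (j : ZMod m) :
    (((q * ZMod.val (j + 1) : ℕ)) : ZMod M) = ((q * ZMod.val j : ℕ) : ZMod M) + q := by
  have key : ∀ a : ℕ, (((q * (a % m) : ℕ)) : ZMod M) = ((q * a : ℕ) : ZMod M) := by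
    intro a
    rw [← Nat.mul_mod_mul_left, ← hM, ZMod.natCast_mod]
  rw [ZMod.val_add, key, mul_add, Nat.cast_add, ZMod.val_one_eq_one_mod, key, mul_one]

/-- **Abstract block regrouping of a cyclic product of window kernels.**  For ANY slice space `X`,
any `(q+1)`-slice kernel `k` and `M = q·m`: the cyclic product over `τ : ZMod M` of
`k(σ_τ, …, σ_{τ+q})` is the cyclic product over the blocks `j : ZMod m` of the block kernels
`∏_{i<q} k((Σ_j ++ Σ_{j+1}) ∘ (l ↦ i + l))`, `Σ_j = (σ_{qj+i'})_{i'<q}`. [folklore] -/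
theorem birMulti_prod_blocks_kernel {X : Type*} {M q m : ℕ} [NeZero M] [NeZero m] (hM : M = q * m)
    (k : (Fin (q + 1) → X) → ℂ) (σ : ZMod M → X) :
    ∏ τ : ZMod M, k (fun l : Fin (q + 1) => σ (τ + ((l : ℕ) : ZMod M))) =
      ∏ j : ZMod m, ∏ i : Fin q, k (fun l : Fin (q + 1) => Fin.append
            (fun i' : Fin q => σ (((q * ZMod.val j + i' : ℕ)) : ZMod M))
            (fun i' : Fin q => σ (((q * ZMod.val (j + 1) + i' : ℕ)) : ZMod M))
            ⟨(i : ℕ) + l, birMulti_window_lt i l⟩) := by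
  rw [birMulti_prod_blocks hM]
  refine Finset.prod_congr rfl fun j _ => Finset.prod_congr rfl fun i _ => congrArg k ?_
  -- the window starting at slice `i` of block `j`, read from the pair of blocks `(j, j+1)`
  funext l
  by_cases h : (i : ℕ) + l < q
  · have hidx : (⟨(i : ℕ) + l, birMulti_window_lt i l⟩ : Fin (q + q)) = Fin.castAdd q ⟨i + l, h⟩ :=
      Fin.ext rfl
    rw [hidx, Fin.append_left]
    congr 1
    simp only [Nat.cast_add]
    ring
  · have hle : q ≤ (i : ℕ) + l := not_lt.mp h
    have hlt2 : (i : ℕ) + l - q < q := by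
      have := birMulti_window_lt i l
      omega
    have hidx : (⟨(i : ℕ) + l, birMulti_window_lt i l⟩ : Fin (q + q)) =
        Fin.natAdd q ⟨(i : ℕ) + l - q, hlt2⟩ := by
      ext
      simp only [Fin.natAdd_mk]
      omega
    rw [hidx, Fin.append_right]
    congr 1
    have e1 : (((i : ℕ) + l - q : ℕ) : ZMod M) = ((i : ℕ) : ZMod M) + ((l : ℕ) : ZMod M) - q := by
      rw [eq_sub_iff_add_eq, ← Nat.cast_add, ← Nat.cast_add, Nat.sub_add_cancel hle]
    simp only [Nat.cast_add]
    rw [birMulti_blockIndex_succ hM, e1]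
    ring

/-- **Block factorisation (`r = q + 1`, `M = q·m`).**  Grouping the time slices into the `m` blocks
`Σ_j = (σ_{qj}, …, σ_{qj+q-1})` of `q = r - 1` consecutive slices, the weight is the cyclic product over
`j : ZMod m` of the block transfer kernels of §4,
`exp(-A θ) = ∏_j T(Σ_j, Σ_{j+1})`, `T(Σ, Σ') = ∏_{i<q} k_r((Σ ++ Σ') ∘ (l ↦ i + l))`
— the path-integral form of `Z = Tr T^m` for the `S`-pseudo-Hermitian multi-slice transfer operator
(`birMulti_block_pseudoHerm`).  For `q = 1` (`r = 2`) this is `birAction_factorises`. [folklore] -/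
theorem birMulti_action_factorises_blocks {q : ℕ} (K : ℝ) (c : Table (q + 1)) (L M m : ℕ)
    [NeZero L] [NeZero M] [NeZero m] (hM : M = q * m) (σ : ZMod M → TorusSite 2 L → ℝ) :
    Complex.exp (-(action K c L M (fun s => σ s.2 s.1))) =
      ∏ j : ZMod m, ∏ i : Fin q, Complex.exp (-((K : ℂ) * ∑ x : TorusSite 2 L, genF c (fun w =>
        (fun l : Fin (q + 1) => Fin.append
            (fun i' : Fin q => σ (((q * ZMod.val j + i' : ℕ)) : ZMod M))
            (fun i' : Fin q => σ (((q * ZMod.val (j + 1) + i' : ℕ)) : ZMod M))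
            ⟨(i : ℕ) + l, birMulti_window_lt i l⟩) w.2.2
          (x + ![((w.1 : ℕ) : ZMod L), ((w.2.1 : ℕ) : ZMod L)])))) := by
  rw [birMulti_action_factorises]
  exact birMulti_prod_blocks_kernel hM (fun η : Fin (q + 1) → TorusSite 2 L → ℝ =>
    Complex.exp (-((K : ℂ) * ∑ x : TorusSite 2 L, genF c (fun w =>
      η w.2.2 (x + ![((w.1 : ℕ) : ZMod L), ((w.2.1 : ℕ) : ZMod L)]))))) σ

end Summit.HubbardSuperconductivity.HubbardSuperconductivity.Theorems

end
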